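import Literature.Computability.Cryptography.LWEBinaryHybrids
import Literature.Computability.Cryptography.RegevBDDToLWESample
import HarnessLib

/-!
# BLPRS 2013, Lemma 4.9, first hybrid: the noise `h - ⟨ē, z̄⟩` of `H₁` is `4ε`-close to `Ψ̄_{α'}` (Lemma 2.9 discretised)

Topic `Computability/Cryptography` (LWE), grouping namespace `LWE`. Proved glue (no named fact) towards
`Literature.Computability.Cryptography.blprs_gapSVP_sqrt_dim_to_lwe_classical` (pqc.S21): the analytic
input `hη` of `advantage_hybridH₀_le` (`LWEBinaryHybridZero.lean`, BLPRS Lemma 4.9 in the discrete model)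
— the one-coordinate closeness of the secret-dependent noise of `H₁` to the Gaussian noise of `H₀` — from
the tree's **Regev 2009, Cor. 3.10 = BLPRS Lemma 2.9** (`Regev2009.corollary_3_10`,
`GaussianNoiseOneDim.lean`), pushed through the rounding `⌊Q·⌉ mod Q` of the discretised interfaces:

> *"Using `‖z‖ ≤ √n` and that `β ≥ √2 η_ε(ℤⁿ)/q`, it follows by Lemma 2.9 that the statistical distance
> between `-Nᵀz + h` and `D^m_{α'}` is at most `4mε`"* (arXiv:1306.0281, proof of Lemma 4.9), where
> **Lemma 2.9**: for `v ← D_{Λ+u,r}`, `e ← D_α`, `⟨z, v⟩ + e` is within statistical distance `4ε` of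
> `D_β`, `β = √((r‖z‖)² + α²)`, provided `η_ε(Λ) ≤ 1/√(1/r² + (‖z‖/α)²)`.

One coordinate of `-Nᵀz + h` is `h - ⟨v, z⟩` with `v` a column of `N`, `v ← D_{q⁻¹ℤⁿ,β}`: in the `×q`
integer model of `ExtLWE.lean` / `LWEBinaryHybrids.lean` the column is the integer vector `e = q v` of
law `χ_N`, the noise of `H₁` is `noiseH₁ χ_N Ψ̄_γ z̄ =` law of `⌊q h⌉ - ⟨e, z⟩ mod q = ⌊q(h - ⟪z, v⟫)⌉ mod q`,
and the target is `Ψ̄_{α'} =` law of `⌊q D_{α'}⌉ mod q`.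

## Results (a lattice `L ⊆ E` with `ℤ`-basis `b` indexed by `Fin n`, modulus `Q`)

* `latticeNoiseLaw b r` — `χ_N`: the integer coordinates of `x ← D_{L,r}`;
* `discretizedGaussian_map_sub_intCast` — `Ψ̄_γ` shifted by an integer `c` is `Regev2009.noiseZMod Q γ (-c/Q)`
  (the law of `⌊Q(e - c/Q)⌉ mod Q`);
* `noiseH₁_latticeNoiseLaw_eq_bind` — the noise of `H₁` as the mixture over `x ← D_{L,r}` of
  `noiseZMod Q γ ⟪-z_E, x⟫`, for any `z_E ∈ E` representing the pairing: `⟪z_E, x⟫ = ⟨coords x, z⟩/Q`;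
* **`tvDist_noiseH₁_discretizedGaussian_le`** — if `η_ε(L) ≤ 1/√(1/r² + (‖z_E‖/γ)²)` (`0 < ε ≤ 1/2`) then
  `Δ(noiseH₁ χ_N Ψ̄_γ z̄, Ψ̄_{√(‖z_E‖²r² + γ²)}) ≤ 4ε`. For BLPRS: `L = Q⁻¹ℤⁿ` with its standard basis,
  `z_E = z` (so `⟪z, v⟫ = ⟨Qv, z⟩/Q`), `r = β`, `γ` the width of `h`, giving `α' = √(β²‖z‖² + γ²)`; the
  instantiation of `L` and the bound on `η_ε` (Lemma 2.5) are left to the assembly, as in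
  `ModulusSwitchCore.lean`.

## References

* Z. Brakerski, A. Langlois, C. Peikert, O. Regev, D. Stehlé, *Classical hardness of learning with errors*,
  STOC 2013; arXiv:1306.0281, Lemma 2.9 and the proof of Lemma 4.9 (first hybrid).
* O. Regev, *On lattices, learning with errors, random linear codes, and cryptography*, J. ACM 56 (2009),
  Corollary 3.10 [RegevLWE2009].
-/

noncomputable section

open MeasureTheory ProbabilityTheory Module Literature.Algebra.EuclideanLattices
open scoped Real ENNReal InnerProductSpace NNReal
open Matrix

namespace Literature.Computability.Cryptography

namespace LWE

variable {E : Type*} [NormedAddCommGroup E] [InnerProductSpace ℝ E] [FiniteDimensional ℝ E]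
  [MeasurableSpace E] [BorelSpace E]
variable {L : Submodule ℤ E} [DiscreteTopology L] [IsZLattice ℝ L]
variable {n : ℕ} (b : Basis (Fin n) ℤ L) (Q : ℕ) [NeZero Q]

/-- **`χ_N` from the lattice Gaussian**: the integer coordinates (in the basis `b`) of `x ← D_{L,r}` — for
`L = Q⁻¹ℤⁿ` with its standard basis, the integer vector `Q v` of a column `v ← D_{Q⁻¹ℤⁿ,r}` of `N`.
[cite: BrakerskiEtAl2013, Lemma 4.9 (proof: "N ← D^{n×m}_{q⁻¹ℤ,β}")] -/
def latticeNoiseLaw (r : ℝ) : PMF (Fin n → ℤ) :=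
  (discreteGaussian L r 0).map fun x j => b.repr x j

omit [NeZero Q] in
/-- **`Ψ̄_γ` shifted by an integer**: `(Ψ̄_γ).map (· - c̄) = ` law of `⌊Q(-c/Q + e)⌉ mod Q`
(`= Regev2009.noiseZMod Q γ (-c/Q)`), since `⌊Q(k/Q + e)⌉ = k + ⌊Qe⌉`. [folklore] -/
theorem discretizedGaussian_map_sub_intCast [NeZero Q] (γ : ℝ) (c : ℤ) :
    (discretizedGaussian Q γ).map (fun k : ZMod Q => k - (c : ZMod Q)) =
      Regev2009.noiseZMod Q γ (((-c : ℤ) : ℝ) / Q) := by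
  rw [← Regev2009.noiseZMod_zero]
  unfold Regev2009.noiseZMod
  have hmeas0 : Measurable fun e : ℝ => discretize Q (0 + e) :=
    (measurable_discretize Q).comp (measurable_const_add 0)
  have hmeasc : Measurable fun e : ℝ => discretize Q (((-c : ℤ) : ℝ) / Q + e) :=
    (measurable_discretize Q).comp (measurable_const_add _)
  haveI : IsProbabilityMeasure ((gaussianReal 0 (Real.toNNReal (γ ^ 2 / (2 * π)))).map
      fun e => discretize Q (0 + e)) := Measure.isProbabilityMeasure_map hmeas0.aemeasurable
  haveI : IsProbabilityMeasure ((gaussianReal 0 (Real.toNNReal (γ ^ 2 / (2 * π)))).map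
      fun e => discretize Q (((-c : ℤ) : ℝ) / Q + e)) := Measure.isProbabilityMeasure_map hmeasc.aemeasurable
  apply PMF.toMeasure_injective
  rw [← PMF.toMeasure_map _ _ (measurable_of_countable _), Measure.toPMF_toMeasure, Measure.toPMF_toMeasure,
    Measure.map_map (measurable_of_countable _) hmeas0]
  refine Measure.map_congr (ae_of_all _ fun e => ?_)
  simp only [Function.comp_apply, zero_add]
  rw [Regev2009.discretize_intCast_div_add, Int.cast_neg, sub_eq_add_neg, add_comm]

omit [FiniteDimensional ℝ E] [MeasurableSpace E] [BorelSpace E] [DiscreteTopology L] [IsZLattice ℝ L]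
  [NeZero Q] in
/-- The pairing hypothesis turns `-⟨coords x, z⟩/Q` into `⟪-z_E, x⟫`. [folklore] -/
theorem neg_intCast_dotProduct_div_eq_inner {z : Fin n → ℤ} {zE : E} (x : L)
    (hpair : ⟪zE, (x : E)⟫_ℝ = ((((fun j => b.repr x j) ⬝ᵥ z : ℤ)) : ℝ) / Q) :
    (((-((fun j => b.repr x j) ⬝ᵥ z) : ℤ) : ℝ) / Q) = ⟪-zE, (x : E)⟫_ℝ := by
  rw [inner_neg_left, hpair, Int.cast_neg, neg_div]

omit [MeasurableSpace E] [BorelSpace E] [IsZLattice ℝ L] in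
/-- **The noise of `H₁` as a mixture over the lattice Gaussian**: for `χ_N = latticeNoiseLaw b r` and
`χ_h = Ψ̄_γ`, `noiseH₁ χ_N Ψ̄_γ z̄ = ∑_x D_{L,r}(x) · noiseZMod Q γ ⟪-z_E, x⟫`, where `z_E ∈ E` represents the
pairing with `z` in the basis `b` (`⟪z_E, x⟫ = ⟨coords x, z⟩/Q`). [cite: BrakerskiEtAl2013, Lemma 4.9 (proof, "-Nᵀz + h")] -/
theorem noiseH₁_latticeNoiseLaw_eq_bind (r γ : ℝ) (z : Fin n → ℤ) (zE : E)
    (hpair : ∀ x : L, ⟪zE, (x : E)⟫_ℝ = ((((fun j => b.repr x j) ⬝ᵥ z : ℤ)) : ℝ) / Q) :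
    noiseH₁ (latticeNoiseLaw b r) (discretizedGaussian Q γ) (intCastVec z : Fin n → ZMod Q) =
      (discreteGaussian L r 0).bind fun x => Regev2009.noiseZMod Q γ ⟪-zE, (x : E)⟫_ℝ := by
  unfold noiseH₁ latticeNoiseLaw
  rw [PMF.bind_map]
  refine congrArg _ (funext fun x => ?_)
  simp only [Function.comp_apply]
  rw [← neg_intCast_dotProduct_div_eq_inner b Q x (hpair x), ← discretizedGaussian_map_sub_intCast,
    cast_dotProduct]

/-- **BLPRS Lemma 2.9 for the noise of `H₁`, discretised.** Let `χ_N = latticeNoiseLaw b r` (the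
coordinates of `x ← D_{L,r}`), `z` an integer vector and `z_E ∈ E` with `⟪z_E, x⟫ = ⟨coords x, z⟩/Q` for all
`x ∈ L`. If `0 < ε ≤ 1/2`, `0 < r`, `0 < γ` and `η_ε(L) ≤ 1/√(1/r² + (‖z_E‖/γ)²)`, then
`Δ(noiseH₁ χ_N Ψ̄_γ z̄, Ψ̄_{√(‖z_E‖² r² + γ²)}) ≤ 4ε` — the hypothesis `hη` of `advantage_hybridH₀_le` for the
Gaussian instantiation, `α' = √(β²‖z‖² + γ²)`. (Event by event this is `Regev2009.corollary_3_10` with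
`u = 0` on the preimage of the event under `⌊Q·⌉ mod Q`.) [cite: BrakerskiEtAl2013, Lemma 2.9 and Lemma 4.9 (proof)] -/
theorem tvDist_noiseH₁_discretizedGaussian_le {ε r γ : ℝ} (hε : 0 < ε) (hε' : ε ≤ 1 / 2) (hr : 0 < r)
    (hγ : 0 < γ) (z : Fin n → ℤ) (zE : E)
    (hpair : ∀ x : L, ⟪zE, (x : E)⟫_ℝ = ((((fun j => b.repr x j) ⬝ᵥ z : ℤ)) : ℝ) / Q)
    (hη : smoothingParameter L ε ≤ 1 / Real.sqrt (1 / r ^ 2 + (‖zE‖ / γ) ^ 2)) :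
    (noiseH₁ (latticeNoiseLaw b r) (discretizedGaussian Q γ) (intCastVec z : Fin n → ZMod Q)).tvDist
        (discretizedGaussian Q (Real.sqrt (‖zE‖ ^ 2 * r ^ 2 + γ ^ 2))) ≤ 4 * ε := by
  classical
  rw [noiseH₁_latticeNoiseLaw_eq_bind b Q r γ z zE hpair]
  refine PMF.tvDist_le_of_forall_toOuterMeasure_sub_le _ _ fun S => ?_
  set B : Set ℝ := discretize Q ⁻¹' S with hB
  have hBm : MeasurableSet B := measurable_discretize Q S.to_countable.measurableSet
  -- the event on the left: a mixture over the lattice Gaussian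
  have hleft : ((((discreteGaussian L r 0).bind fun x => Regev2009.noiseZMod Q γ ⟪-zE, (x : E)⟫_ℝ).toOuterMeasure
      S).toReal) = ∑' x : L, (discreteGaussian L r (-0) x).toReal *
        (gaussianReal 0 (Real.toNNReal (γ ^ 2 / (2 * π)))).real
          ((fun e : ℝ => ⟪-zE, (x : E) + 0⟫_ℝ + e) ⁻¹' B) := by
    rw [PMF.toReal_toOuterMeasure_bind_apply, neg_zero]
    refine tsum_congr fun x => ?_
    rw [Regev2009.toReal_toOuterMeasure_noiseZMod, add_zero]
    rfl
  -- the event on the right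
  have hright : (((discretizedGaussian Q (Real.sqrt (‖zE‖ ^ 2 * r ^ 2 + γ ^ 2))).toOuterMeasure S).toReal) =
      (gaussianReal 0 (Real.toNNReal ((‖-zE‖ ^ 2 * r ^ 2 + γ ^ 2) / (2 * π)))).real B := by
    rw [← Regev2009.noiseZMod_zero, Regev2009.toReal_toOuterMeasure_noiseZMod, norm_neg,
      Real.sq_sqrt (by positivity)]
    congr 1
    ext e
    simp [hB]
  rw [hleft, hright]
  have hη' : smoothingParameter L ε ≤ 1 / Real.sqrt (1 / r ^ 2 + (‖-zE‖ / γ) ^ 2) := by rwa [norm_neg]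
  exact (le_abs_self _).trans (Regev2009.corollary_3_10 L 0 (-zE) hε hε' hr hγ hη' hBm)

end LWE

end Literature.Computability.Cryptography

end
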